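import Literature.AlgebraicGeometry.Motives.ClosedSubvarietyOfPoint
import Literature.AlgebraicGeometry.Motives.SubschemeCyclesRatStalkProofs
import Literature.AlgebraicGeometry.Motives.SubschemeCyclesFundamentalProofs
import Literature.AlgebraicGeometry.Motives.SubschemeCyclesDimProofs
import Literature.AlgebraicGeometry.Motives.CyclesDivisorDimensionProofs
import HarnessLib

/-!
# The irreducible components of `f⁻¹(W)` and their local rings (for Fulton's Theorem 1.7)

For a flat morphism `f : X ⟶ Y` of relative dimension `e` between schemes locally of finite type over a
field and a closed subvariety `W ⊆ Y` of dimension `d + 1`, the inverse image scheme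
`W' = f⁻¹(W) = W ×_Y X` (Mathlib `pullback W.ι f`) is purely `(d + 1 + e)`-dimensional and its
irreducible components `V_η = closure {η}` (with the reduced structure,
`ClosedSubvariety.ofPoint W' η`, `η` a point maximal for the specialisation order) dominate `W`
(Fulton, *Intersection Theory*, §1.7 and Lemma 1.7.1; App. B.2.5). This file collects these facts in
the form needed for the proof of Theorem 1.7 (`SubschemeCyclesRatFiniteTypeHoldsProofs`):

* `isMax_pullback`: `ℓ(𝒪_{W',η}) ≠ 0`, `η ↦` generic point of `W`, `η` generic in its fibre;
* `height_snd_of_isMax`: `dim V_η = d + 1 + e`; `height_add_coheight_ofPointPt`: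
  `dim closure {w'} + dim 𝒪_{V_η,w'} = d + 1 + e` for `η ⤳ w'`;
* `divFun_comp_ofPoint_apply`: the coefficient of `[div g]`, `g ∈ K(V_η)`, at a point `w'` of `W'`;
* `ker_stalkMap_ofPointPt`, `ringKrullDim_quotient_comap_maximalIdeal`,
  `ord_quotient_comap_maximalIdeal`: the local ring `𝒪_{V_η,w'} = 𝒪_{W',w'}/𝔭_η`, its dimension and its
  orders of vanishing, read in `B = 𝒪_{W',w'}` (where `𝔭_η` is the minimal prime of `B` defined by `η`);
  `ringOrd_map_of_surjective`: `Ring.ord` along a surjection.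

## References

* W. Fulton, *Intersection Theory*, 2nd ed. (1998), §1.3, §1.5, §1.7 (Lemma 1.7.1), App. B.2.5.
* The Stacks Project, Tags 02JW (dimension formula), 0A21 (dimension of locally algebraic schemes).
-/

universe u

open CategoryTheory AlgebraicGeometry Limits Order TopologicalSpace Topology IsLocalRing

namespace Literature.AlgebraicGeometry.Motives

/-! ### `Ring.ord` under a surjection -/

/-- For a surjective ring homomorphism `σ : B → C`, orders of vanishing in `C` are orders in `B ⧸ ker σ`:
`Ring.ord C (σ x) = Ring.ord (B ⧸ ker σ) x̄` (`C ≅ B/ker σ`). [folklore] -/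
theorem ringOrd_map_of_surjective {B C : Type*} [CommRing B] [CommRing C] (σ : B →+* C)
    (hσ : Function.Surjective σ) (x : B) :
    Ring.ord C (σ x) = Ring.ord (B ⧸ RingHom.ker σ) (Ideal.Quotient.mk (RingHom.ker σ) x) := by
  unfold Ring.ord
  have h1 : Ideal.span {σ x} = (RingHom.ker σ ⊔ Ideal.span {x}).map σ := by
    rw [Ideal.map_sup, Ideal.map_span, Set.image_singleton, (Ideal.map_eq_bot_iff_le_ker σ).mpr le_rfl,
      bot_sup_eq]
  have h2 : Ideal.span {Ideal.Quotient.mk (RingHom.ker σ) x} =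
      (RingHom.ker σ ⊔ Ideal.span {x}).map (Ideal.Quotient.mk (RingHom.ker σ)) := by
    rw [Ideal.map_sup, Ideal.map_span, Set.image_singleton, (Ideal.map_eq_bot_iff_le_ker _).mpr
      (by rw [Ideal.mk_ker]), bot_sup_eq]
  rw [h1, h2, length_quotient_map_eq_of_surjective σ hσ _ le_sup_left,
    length_quotient_map_eq_of_surjective _ Ideal.Quotient.mk_surjective _ (by rw [Ideal.mk_ker]; exact le_sup_left)]

/-! ### The components of the inverse image -/

section Components

variable {X Y : Scheme.{u}} (f : X ⟶ Y) (W : ClosedSubvariety Y)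

open scoped Classical in
/-- The principal divisor `[div g]` of a rational function `g` on the subvariety `closure {η}` (reduced) of a
closed subscheme `i : W' ↪ X`, evaluated at a point `i w'`: the order of `g` at the point of
`closure {η}` over `w'` if `η ⤳ w'`, and `0` otherwise (Fulton §1.3, `[div r] = Σ ord_V(r)[V]`).
[folklore] -/
theorem divFun_comp_ofPoint_apply {W' : Scheme.{u}} (i : W' ⟶ X) [IsClosedImmersion i]
    [IsLocallyNoetherian W'] (η w' : W')
    (g : (ClosedSubvariety.ofPoint W' η).carrier.functionField) :
    ((ClosedSubvariety.ofPoint W' η).comp i).divFun g (i w') =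
      if h : η ⤳ w' then Scheme.ord g (ClosedSubvariety.ofPointPt η h) else 0 := by
  rw [ClosedSubvariety.divFun_comp_apply]
  split_ifs with h
  · exact (ClosedSubvariety.ofPoint W' η).divFun_ι_base g (ClosedSubvariety.ofPointPt η h)
  · refine (ClosedSubvariety.ofPoint W' η).divFun_of_notMem_range g fun hw ↦ h ?_
    rw [ClosedSubvariety.range_ofPoint_ι] at hw
    exact specializes_iff_mem_closure.mpr hw

variable [Flat f] [IsLocallyNoetherian W.carrier] [IsLocallyNoetherian X]

/-- **Components of `f⁻¹(W)` for `f` flat** (Fulton, *Intersection Theory*, Lemma 1.7.1 and B.2.5: the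
irreducible components of `f⁻¹(V)` dominate `V`). For a generic point `η` of an irreducible component of
`W' = f⁻¹(W) = W ×_Y X` (a point maximal for the specialisation order): the geometric multiplicity
`ℓ(𝒪_{W',η})` is finite and nonzero, `η` lies over the generic point of `W`, and `η` is a generic point
of a component of its fibre `X_{f η}` — all read off from `ℓ(𝒪_{W',η}) = ℓ(𝒪_{W,w}) · ℓ(𝒪_{X_{fη},η})`
(`stalkLength_pullback_eq_mul`, Fulton Lemma A.4.1). [cite: Fulton1998, Lemma 1.7.1] -/
theorem isMax_pullback (η : ↥(pullback W.ι f)) (hη : IsMax η) :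
    stalkLength (pullback W.ι f) η ≠ 0 ∧
      pullback.fst W.ι f η = genericPoint W.carrier ∧
        IsMax (f.asFiber (pullback.snd W.ι f η)) := by
  haveI : IsLocallyNoetherian (pullback W.ι f) :=
    LocallyOfFiniteType.isLocallyNoetherian (pullback.snd W.ι f)
  have hgen : IsGenericComponentPoint (pullback W.ι f) η := isGenericComponentPoint_of_isMax hη
  have hne : stalkLength (pullback W.ι f) η ≠ 0 := by
    simp only [stalkLength, ne_eq, ENat.toNat_eq_zero, not_or]
    exact ⟨Module.length_pos.ne', hgen.ne⟩
  have hmul := stalkLength_pullback_eq_mul f W.toClosedSubscheme η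
  change stalkLength (pullback W.ι f) η = stalkLength W.carrier (pullback.fst W.ι f η) *
    stalkLength (f.fiber (f (pullback.snd W.ι f η))) (f.asFiber (pullback.snd W.ι f η)) at hmul
  rw [hmul] at hne
  refine ⟨hmul ▸ hne, ?_, ?_⟩
  · have h1 : stalkLength W.carrier (pullback.fst W.ι f η) ≠ 0 := left_ne_zero_of_mul hne
    have h2 : IsGenericComponentPoint W.carrier (pullback.fst W.ι f η) := by
      by_contra h; exact h1 (stalkLength_eq_zero_of_not_isGenericComponentPoint h)
    exact isGenericComponentPoint_iff_eq_genericPoint.mp h2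
  · have h1 := right_ne_zero_of_mul hne
    have h2 : IsGenericComponentPoint _ (f.asFiber (pullback.snd W.ι f η)) := by
      by_contra h; exact h1 (stalkLength_eq_zero_of_not_isGenericComponentPoint h)
    exact isMax_of_isGenericComponentPoint h2

end Components

/-! ### Dimensions of the components -/

section Dim

variable {k : Type u} [Field k] {X Y : Scheme.{u}} (f : X ⟶ Y) (q : Y ⟶ Spec (.of k))
  [Flat f] [LocallyOfFiniteType f] [LocallyOfFiniteType q] [IsLocallyNoetherian X]
  (W : ClosedSubvariety Y) [IsLocallyNoetherian W.carrier] {d e : ℕ} (hW : W.dim = d + 1)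
  (he : f.IsEquidimensional e)

include q hW he in
/-- **`f⁻¹(W)` is purely `(dim W + n)`-dimensional** (Fulton, *Intersection Theory*, §1.7: "`f⁻¹(V)` is
… a subscheme of `X` of pure dimension `dim(V) + n`"; B.2.5). For `f` flat of relative dimension `e`
between schemes locally of finite type over a field, `W ⊆ Y` a closed subvariety of dimension
`d + 1`, and a generic point `η` of a component of `f⁻¹(W)`: `dim closure {η} = d + 1 + e` in `X` (the
dimension formula `height_eq_height_add_height_asFiber`, Stacks 02JW, at `η`, which is generic in its
fibre over the generic point of `W`). [cite: Fulton1998, §1.7] -/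
theorem height_snd_of_isMax (η : ↥(pullback W.ι f)) (hη : IsMax η) :
    height (pullback.snd W.ι f η) = (d + 1 + e : ℕ) := by
  obtain ⟨-, hgen, hmax⟩ := isMax_pullback f W η hη
  rw [Scheme.height_eq_height_add_height_asFiber f q (pullback.snd W.ι f η), he _ _ hmax]
  have h1 : f (pullback.snd W.ι f η) = W.genericPoint := by
    rw [← Scheme.Hom.comp_apply, ← pullback.condition, Scheme.Hom.comp_apply, hgen]
    rfl
  rw [h1]
  change W.dim + e = _
  rw [hW]
  push_cast
  ring

include q hW he in
/-- **Codimension in a component.** In the situation of `height_snd_of_isMax`, for a point `w'` of the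
component `V_η = closure {η}` of `f⁻¹(W)`: `dim closure {w'} + codim_{V_η} w' = d + 1 + e` (the dimension
formula `dim closure {v} + dim 𝒪_{V,v} = dim V` on the integral scheme `V_η`, locally of finite type over
the field: Stacks 0A21, `Scheme.height_add_coheight_eq_height_top`). In particular all the local rings
`𝒪_{V_η, w'}`, `η ⤳ w'`, have the same dimension. [cite: StacksProject, Tag 0A21] -/
theorem height_add_coheight_ofPointPt (η : ↥(pullback W.ι f)) (hη : IsMax η) {w' : ↥(pullback W.ι f)}
    (h : η ⤳ w') :
    height (pullback.snd W.ι f w') +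
        coheight (ClosedSubvariety.ofPointPt η h) = (d + 1 + e : ℕ) := by
  haveI : IsLocallyNoetherian (pullback W.ι f) :=
    LocallyOfFiniteType.isLocallyNoetherian (pullback.snd W.ι f)
  let V := (ClosedSubvariety.ofPoint (pullback W.ι f) η).comp (pullback.snd W.ι f)
  have h1 := Scheme.height_add_coheight_eq_height_top (V.ι ≫ f ≫ q) (ClosedSubvariety.ofPointPt η h)
  have h2 : height (V.ι (ClosedSubvariety.ofPointPt η h)) = height (ClosedSubvariety.ofPointPt η h) :=
    V.height_ι_base _
  have h3 : height (⊤ : V.carrier) = (d + 1 + e : ℕ) := by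
    rw [← V.dim_eq_height_top, ← height_snd_of_isMax f q W hW he η hη]
    change height (pullback.snd W.ι f ((ClosedSubvariety.ofPoint (pullback W.ι f) η).genericPoint)) = _
    rw [ClosedSubvariety.genericPoint_ofPoint]
  calc height (pullback.snd W.ι f w') + coheight (ClosedSubvariety.ofPointPt η h)
      = height (V.ι (ClosedSubvariety.ofPointPt η h)) + coheight (ClosedSubvariety.ofPointPt η h) := rfl
    _ = _ := by rw [h2]; exact h1.trans h3

end Dim

/-! ### Local rings of the components, read in `𝒪_{W',w'}` -/

/-- `Ring.ord` in quotients by (propositionally) equal ideals agree. [folklore] -/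
theorem ringOrd_quot_congr {B : Type*} [CommRing B] {K K' : Ideal B} (hK : K = K') (x : B) :
    Ring.ord (B ⧸ K) (Ideal.Quotient.mk K x) = Ring.ord (B ⧸ K') (Ideal.Quotient.mk K' x) := by
  subst hK
  rfl

/-! ### Local rings of the component subvarieties, read in `𝒪_{X,z}` -/

section OfPointStalk

variable {X : Scheme.{u}} {x z : X} (h : x ⤳ z)

/-- `𝒪_{V,z} = 𝒪_{X,z} / 𝔭_x` for `V = closure {x}` with its reduced structure: the kernel of
`𝒪_{X,z} → 𝒪_{V,z}` is `𝔭_x = (𝒪_{X,z} → 𝒪_{X,x})⁻¹ 𝔪_x` (restatement of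
`ClosedSubvariety.ker_stalkMap_ofPoint_ι` at the point `ofPointPt x h`, typed over `𝒪_{X,z}`). [folklore] -/
theorem ker_stalkMap_ofPointPt :
    RingHom.ker ((ClosedSubvariety.ofPoint X x).ι.stalkMap (ClosedSubvariety.ofPointPt x h)).hom =
      ((maximalIdeal (X.presheaf.stalk x)).comap (X.presheaf.stalkSpecializes h).hom :
        Ideal (X.presheaf.stalk z)) :=
  ClosedSubvariety.ker_stalkMap_ofPoint_ι x (ClosedSubvariety.ofPointPt x h)

/-- The dimension of `𝒪_{X,z}/𝔭_x` is `dim 𝒪_{V,z}`, the codimension of `z` in `V = closure {x}` (Mathlib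
`ringKrullDim_stalk_eq_coheight` on `V`). [folklore] -/
theorem ringKrullDim_quotient_comap_maximalIdeal :
    ringKrullDim (X.presheaf.stalk z ⧸ (maximalIdeal (X.presheaf.stalk x)).comap
        (X.presheaf.stalkSpecializes h).hom) =
      coheight (ClosedSubvariety.ofPointPt x h) := by
  let σ : X.presheaf.stalk z →+*
      (ClosedSubvariety.ofPoint X x).carrier.presheaf.stalk (ClosedSubvariety.ofPointPt x h) :=
    ((ClosedSubvariety.ofPoint X x).ι.stalkMap (ClosedSubvariety.ofPointPt x h)).hom
  have hσ : Function.Surjective σ :=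
    (ClosedSubvariety.ofPoint X x).ι.stalkMap_surjective (ClosedSubvariety.ofPointPt x h)
  have hker : RingHom.ker σ =
      (maximalIdeal (X.presheaf.stalk x)).comap (X.presheaf.stalkSpecializes h).hom :=
    ker_stalkMap_ofPointPt h
  rw [← ringKrullDim_stalk_eq_coheight,
    ← ringKrullDim_eq_of_ringEquiv (RingHom.quotientKerEquivOfSurjective hσ), hker]

/-- Orders of vanishing computed in `𝒪_{X,z}/𝔭_x` are orders in `𝒪_{V,z}`, `V = closure {x}`:
`Ring.ord (𝒪_{X,z}/𝔭_x) s̄ = Ring.ord 𝒪_{V,z} (s|_V)`. [folklore] -/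
theorem ord_quotient_comap_maximalIdeal (s : X.presheaf.stalk z) :
    Ring.ord (X.presheaf.stalk z ⧸ (maximalIdeal (X.presheaf.stalk x)).comap
        (X.presheaf.stalkSpecializes h).hom) (Ideal.Quotient.mk _ s) =
      Ring.ord ((ClosedSubvariety.ofPoint X x).carrier.presheaf.stalk (ClosedSubvariety.ofPointPt x h))
        (((ClosedSubvariety.ofPoint X x).ι.stalkMap (ClosedSubvariety.ofPointPt x h)).hom s) := by
  let σ : X.presheaf.stalk z →+*
      (ClosedSubvariety.ofPoint X x).carrier.presheaf.stalk (ClosedSubvariety.ofPointPt x h) :=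
    ((ClosedSubvariety.ofPoint X x).ι.stalkMap (ClosedSubvariety.ofPointPt x h)).hom
  have hσ : Function.Surjective σ :=
    (ClosedSubvariety.ofPoint X x).ι.stalkMap_surjective (ClosedSubvariety.ofPointPt x h)
  have hker : RingHom.ker σ =
      (maximalIdeal (X.presheaf.stalk x)).comap (X.presheaf.stalkSpecializes h).hom :=
    ker_stalkMap_ofPointPt h
  change _ = Ring.ord _ (σ s)
  rw [ringOrd_map_of_surjective σ hσ s, ringOrd_quot_congr hker]

end OfPointStalk

end Literature.AlgebraicGeometry.Motives
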